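import Summits.CriticalPhenomena.PercolationContinuityZ3.Theorems.PercNearOneGluingNoHeavyLowerTailSahiQuantC3Principal

/-!
# `NoHeavyLowerTail` (crux stmt-CriticalPhenomena-4575), Sahi programme: **THE TANGENT INEQUALITY `T₃ ≥ 0` FOR CYLINDER PAIRS ON EVERY
# CUBE `{0,1}^ι` WITH A PRODUCT MEASURE** — part 1, the polynomial inequality

Support file (Sahi cell, seat `prim-sahi-p1`, generation 48; `--supports stmt-CriticalPhenomena-4575`).  Pure proofs, standard axioms, no
`sorry`; bookkeeping definitions `cylMass` (product of coordinate probabilities over a finite set = the probability of the cylinder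
'all of `A` open'), `T3cyl` (the 14-term tangent expression of memo FROM-prim-sahi-p2-gen32-TANGENT in these masses) and `excess` (a
termination measure).

THE MATHEMATICS.  Conjecture T₃ (prim-sahi-p2 gen 32) — `T₃ = E₃(1) − E₃′(1) ≥ 0` for three pairs of increasing events `B_i ⊆ T_i` on
`L × coin` — is FALSE on `{0,1}⁴ × coin` for general up-sets (gen 47, `not_tangentPatternPos_four`: the tops there are UNIONS of cylinders)
but holds on chains (all orders, gen 47) and at width 2 (gen 48).  Here: it holds on EVERY cube `{0,1}^ι` with EVERY product measure when the
six events are CYLINDERS `T_i = {ω ⊇ t_i}`, `B_i = {ω ⊇ b_i}`, `t_i ⊆ b_i` (principal up-sets of the Boolean lattice).  With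
`M(A) = ∏_{e∈A} p_e`, `X_S = M(∪_{i∈S} t_i)`, `Y_S = M(∪_{i∈S} b_i)`:
  `T₃ = 2Y₁₂₃ + Σ_i [(X_i − Y_i)X_jk + Y_iX_jX_k − X_iY_jk] − 2X₁X₂X₃ ≥ 0`   (`T3cyl_nonneg`, part 2).
PROOF.  (i) REDUCTION (`T3cyl_erase_le₀/₁/₂`): if a coordinate `e ∈ b_l ∖ t_l` also lies in another bottom `b_j`, removing it from `b_l`
can only DECREASE `T₃` — `Y_l, Y_lj, Y_lk` weakly increase, `Y₁₂₃` is unchanged, and `T₃` is antitone in `Y_l` (coefficient `−Cov_jk(t) ≤ 0`,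
Harris) and in `Y_lj, Y_lk` (coefficients `−X_k, −X_j`).  Iterating (`excess` strictly decreases) reaches a FROZEN configuration: the defects
`δ_l = b_l ∖ t_l` are pairwise disjoint and disjoint from all tops (the Lemma-D move of gen 47, `…SahiTangentAllOrders`, read on masses).
(ii) FROZEN CASE (`T3cyl_nonneg_of_frozen`): then `Y_S = X_S · ∏_{l∈S} r_l`, `r_l = M(δ_l)`, and the IDENTITY
  `T₃ = r₁r₂r₃·E₃(t) + Σ_i (X_iX_jk − X₁X₂X₃)(1 − r_i)(1 − r_jr_k) + X₁X₂X₃·[(1−r₁)(1−r₂)(1−r₃) + Σ_i r_i(1−r_j)(1−r_k)]`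
exhibits `T₃ ≥ 0` from `E₃(t) ≥ 0` (cylinders: the quantitative `C₃` of `…SahiQuantC3Principal`, `quantC3_core`), Harris `X_jk ≥ X_jX_k`, and
`r ∈ [0,1]³` (the last bracket is `P(at most one of three independent events)`).  THIS FILE: masses, `T3cyl`, `E3cyl_nonneg`, the frozen case
and the three one-step reduction lemmas; part 2 (`…SahiTangentCylinderPairs`) runs the induction (`T3cyl_nonneg`) and derives the contraction
inequality for cylinder pairs under `bernoulliWeight`. [this work]
-/

namespace Summit.CriticalPhenomena.PercolationContinuityZ3.Theorems.SahiTangentCyl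

open Finset
open scoped BigOperators

noncomputable section

variable {ι : Type*}

/-! ### Cylinder masses `M(A) = ∏_{e ∈ A} p_e` -/

/-- The probability that all coordinates of `A` are open: `∏_{e∈A} p_e`. [this work] -/
def cylMass (p : ι → ℝ) (A : Finset ι) : ℝ := ∏ e ∈ A, p e

variable {p : ι → ℝ}

/-- Masses are nonnegative. [this work] -/
theorem cylMass_nonneg (hp0 : ∀ e, 0 ≤ p e) (A : Finset ι) : 0 ≤ cylMass p A := prod_nonneg fun e _ => hp0 e

/-- Masses are at most `1`. [this work] -/
theorem cylMass_le_one (hp0 : ∀ e, 0 ≤ p e) (hp1 : ∀ e, p e ≤ 1) (A : Finset ι) : cylMass p A ≤ 1 := by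
  unfold cylMass
  calc ∏ e ∈ A, p e ≤ ∏ e ∈ A, (1 : ℝ) := prod_le_prod (fun e _ => hp0 e) fun e _ => hp1 e
    _ = 1 := prod_const_one

/-- **The mass is antitone in the set**: more required coordinates, smaller probability. [this work] -/
theorem cylMass_anti [DecidableEq ι] (hp0 : ∀ e, 0 ≤ p e) (hp1 : ∀ e, p e ≤ 1) {A B : Finset ι} (h : A ⊆ B) :
    cylMass p B ≤ cylMass p A := by
  unfold cylMass
  rw [← prod_sdiff h]
  have h1 := cylMass_le_one hp0 hp1 (B \ A)
  have h2 := cylMass_nonneg hp0 A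
  unfold cylMass at h1 h2
  nlinarith

/-- **Harris for cylinders**: `M(A)·M(B) ≤ M(A ∪ B)` (`M(A∪B)M(A∩B) = M(A)M(B)` and `M(A∩B) ≤ 1`). [folklore] -/
theorem cylMass_mul_le_union [DecidableEq ι] (hp0 : ∀ e, 0 ≤ p e) (hp1 : ∀ e, p e ≤ 1) (A B : Finset ι) :
    cylMass p A * cylMass p B ≤ cylMass p (A ∪ B) := by
  have h : cylMass p (A ∪ B) * cylMass p (A ∩ B) = cylMass p A * cylMass p B := prod_union_inter
  have h1 := cylMass_le_one hp0 hp1 (A ∩ B)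
  have h2 := cylMass_nonneg hp0 (A ∪ B)
  nlinarith

/-- Disjoint union: `M(A ∪ B) = M(A)·M(B)`. [folklore] -/
theorem cylMass_union_of_disjoint [DecidableEq ι] {A B : Finset ι} (h : Disjoint A B) :
    cylMass p (A ∪ B) = cylMass p A * cylMass p B :=
  prod_union h

/-! ### The tangent expression for cylinder pairs -/

variable [DecidableEq ι]

/-- **`T₃` for three cylinder pairs** `t_i ⊆ b_i` in the masses `X_S = M(∪ t)`, `Y_S = M(∪ b)` (the 14-term form of `…SahiTangentChain`). [this work] -/
def T3cyl (p : ι → ℝ) (t b : Fin 3 → Finset ι) : ℝ :=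
  2 * cylMass p (b 0 ∪ b 1 ∪ b 2)
    + (cylMass p (t 0) - cylMass p (b 0)) * cylMass p (t 1 ∪ t 2)
    + (cylMass p (t 1) - cylMass p (b 1)) * cylMass p (t 0 ∪ t 2)
    + (cylMass p (t 2) - cylMass p (b 2)) * cylMass p (t 0 ∪ t 1)
    + cylMass p (b 0) * cylMass p (t 1) * cylMass p (t 2) + cylMass p (b 1) * cylMass p (t 0) * cylMass p (t 2)
    + cylMass p (b 2) * cylMass p (t 0) * cylMass p (t 1)
    - cylMass p (t 0) * cylMass p (b 1 ∪ b 2) - cylMass p (t 1) * cylMass p (b 0 ∪ b 2) - cylMass p (t 2) * cylMass p (b 0 ∪ b 1)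
    - 2 * (cylMass p (t 0) * cylMass p (t 1) * cylMass p (t 2))

/-- **`E₃ ≥ 0` for three cylinders** (in masses): `2M(t₀∪t₁∪t₂) − Σ M(t_i)M(t_j∪t_k) + ΠM(t_i) ≥ 0` — from the quantitative `C₃`
`quantC3_core` of `…SahiQuantC3Principal` with `u_e = [e ∈ t₀] ? p_e : 1`, etc. [this work] -/
theorem E3cyl_nonneg [Fintype ι] (hp0 : ∀ e, 0 ≤ p e) (hp1 : ∀ e, p e ≤ 1) (t : Fin 3 → Finset ι) :
    0 ≤ 2 * cylMass p (t 0 ∪ t 1 ∪ t 2) - (cylMass p (t 0) * cylMass p (t 1 ∪ t 2) + cylMass p (t 1) * cylMass p (t 0 ∪ t 2)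
      + cylMass p (t 2) * cylMass p (t 0 ∪ t 1)) + cylMass p (t 0) * cylMass p (t 1) * cylMass p (t 2) := by
  have h01 : ∀ (A : Finset ι) (e : ι), 0 ≤ (if e ∈ A then p e else 1 : ℝ) ∧ (if e ∈ A then p e else 1 : ℝ) ≤ 1 := fun A e => by
    split_ifs
    · exact ⟨hp0 e, hp1 e⟩
    · exact ⟨zero_le_one, le_rfl⟩
  have core := SahiQuantC3.quantC3_core (fun e => if e ∈ t 0 then p e else 1) (fun e => if e ∈ t 1 then p e else 1)
    (fun e => if e ∈ t 2 then p e else 1) (univ : Finset ι) (fun e => (h01 _ e).1) (fun e => (h01 _ e).1) (fun e => (h01 _ e).1)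
    (fun e => (h01 _ e).2) (fun e => (h01 _ e).2) (fun e => (h01 _ e).2)
  -- identify the products with cylinder masses
  have single : ∀ A : Finset ι, (∏ e, (if e ∈ A then p e else 1 : ℝ)) = cylMass p A := fun A => by
    unfold cylMass; rw [prod_ite_mem, univ_inter]
  have pair : ∀ A B : Finset ι, (∏ e, min (if e ∈ A then p e else 1 : ℝ) (if e ∈ B then p e else 1)) = cylMass p (A ∪ B) := by
    intro A B
    rw [← single]
    refine prod_congr rfl fun e _ => ?_
    by_cases hA : e ∈ A <;> by_cases hB : e ∈ B <;> simp [hA, hB, mem_union, hp1 e]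
  have triple : (∏ e, min (if e ∈ t 0 then p e else 1 : ℝ) (min (if e ∈ t 1 then p e else 1) (if e ∈ t 2 then p e else 1)))
      = cylMass p (t 0 ∪ t 1 ∪ t 2) := by
    rw [← single]
    refine prod_congr rfl fun e _ => ?_
    by_cases h0 : e ∈ t 0 <;> by_cases h1 : e ∈ t 1 <;> by_cases h2 : e ∈ t 2 <;> simp [h0, h1, h2, mem_union, hp1 e]
  rw [triple, single, single, single, pair, pair, pair] at core
  have nX2 := cylMass_nonneg hp0 (t 2)
  have har01 := cylMass_mul_le_union hp0 hp1 (t 0) (t 1)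
  have hPT : cylMass p (t 0) * cylMass p (t 1) * cylMass p (t 2) ≤ cylMass p (t 0 ∪ t 1 ∪ t 2) :=
    (mul_le_mul_of_nonneg_right har01 nX2).trans (cylMass_mul_le_union hp0 hp1 _ _)
  linarith

/-! ### The frozen case -/

/-- **The frozen identity, as a real inequality.**  With `Y_S = X_S·∏_{l∈S} r_l`:
`T₃ = r₀r₁r₂·E₃ + Σ_i (X_iX_jk − X₀X₁X₂)(1−r_i)(1−r_jr_k) + X₀X₁X₂[(1−r₀)(1−r₁)(1−r₂) + Σ r_i(1−r_j)(1−r_k)] ≥ 0`. [this work] -/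
theorem frozen_poly_nonneg {X0 X1 X2 X01 X02 X12 X012 r0 r1 r2 : ℝ} (nX0 : 0 ≤ X0) (nX1 : 0 ≤ X1) (nX2 : 0 ≤ X2)
    (har12 : X1 * X2 ≤ X12) (har02 : X0 * X2 ≤ X02) (har01 : X0 * X1 ≤ X01)
    (hE3 : 0 ≤ 2 * X012 - (X0 * X12 + X1 * X02 + X2 * X01) + X0 * X1 * X2)
    (nr0 : 0 ≤ r0) (nr1 : 0 ≤ r1) (nr2 : 0 ≤ r2) (lr0 : r0 ≤ 1) (lr1 : r1 ≤ 1) (lr2 : r2 ≤ 1) :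
    0 ≤ 2 * (X012 * (r0 * r1 * r2))
      + (X0 - X0 * r0) * X12 + (X1 - X1 * r1) * X02 + (X2 - X2 * r2) * X01
      + X0 * r0 * X1 * X2 + X1 * r1 * X0 * X2 + X2 * r2 * X0 * X1
      - X0 * (X12 * (r1 * r2)) - X1 * (X02 * (r0 * r2)) - X2 * (X01 * (r0 * r1))
      - 2 * (X0 * X1 * X2) := by
  have t1 : 0 ≤ r0 * r1 * r2 * (2 * X012 - (X0 * X12 + X1 * X02 + X2 * X01) + X0 * X1 * X2) :=
    mul_nonneg (mul_nonneg (mul_nonneg nr0 nr1) nr2) hE3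
  have q12 : 0 ≤ 1 - r1 * r2 := by nlinarith
  have q02 : 0 ≤ 1 - r0 * r2 := by nlinarith
  have q01 : 0 ≤ 1 - r0 * r1 := by nlinarith
  have t2 : 0 ≤ (X0 * X12 - X0 * X1 * X2) * ((1 - r0) * (1 - r1 * r2)) :=
    mul_nonneg (by nlinarith [mul_le_mul_of_nonneg_left har12 nX0]) (mul_nonneg (by linarith) q12)
  have t3 : 0 ≤ (X1 * X02 - X0 * X1 * X2) * ((1 - r1) * (1 - r0 * r2)) :=
    mul_nonneg (by nlinarith [mul_le_mul_of_nonneg_left har02 nX1]) (mul_nonneg (by linarith) q02)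
  have t4 : 0 ≤ (X2 * X01 - X0 * X1 * X2) * ((1 - r2) * (1 - r0 * r1)) :=
    mul_nonneg (by nlinarith [mul_le_mul_of_nonneg_left har01 nX2]) (mul_nonneg (by linarith) q01)
  have a1 : 0 ≤ (1 - r0) * (1 - r1) * (1 - r2) := mul_nonneg (mul_nonneg (by linarith) (by linarith)) (by linarith)
  have a2 : 0 ≤ r0 * ((1 - r1) * (1 - r2)) := mul_nonneg nr0 (mul_nonneg (by linarith) (by linarith))
  have a3 : 0 ≤ r1 * ((1 - r0) * (1 - r2)) := mul_nonneg nr1 (mul_nonneg (by linarith) (by linarith))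
  have a4 : 0 ≤ r2 * ((1 - r0) * (1 - r1)) := mul_nonneg nr2 (mul_nonneg (by linarith) (by linarith))
  have t5 : 0 ≤ X0 * X1 * X2 * ((1 - r0) * (1 - r1) * (1 - r2) + (r0 * ((1 - r1) * (1 - r2)) + r1 * ((1 - r0) * (1 - r2))
      + r2 * ((1 - r0) * (1 - r1)))) := mul_nonneg (mul_nonneg (mul_nonneg nX0 nX1) nX2) (by linarith)
  have ident : 2 * (X012 * (r0 * r1 * r2))
      + (X0 - X0 * r0) * X12 + (X1 - X1 * r1) * X02 + (X2 - X2 * r2) * X01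
      + X0 * r0 * X1 * X2 + X1 * r1 * X0 * X2 + X2 * r2 * X0 * X1
      - X0 * (X12 * (r1 * r2)) - X1 * (X02 * (r0 * r2)) - X2 * (X01 * (r0 * r1))
      - 2 * (X0 * X1 * X2)
      = r0 * r1 * r2 * (2 * X012 - (X0 * X12 + X1 * X02 + X2 * X01) + X0 * X1 * X2)
      + (X0 * X12 - X0 * X1 * X2) * ((1 - r0) * (1 - r1 * r2)) + (X1 * X02 - X0 * X1 * X2) * ((1 - r1) * (1 - r0 * r2))
      + (X2 * X01 - X0 * X1 * X2) * ((1 - r2) * (1 - r0 * r1))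
      + X0 * X1 * X2 * ((1 - r0) * (1 - r1) * (1 - r2) + (r0 * ((1 - r1) * (1 - r2)) + r1 * ((1 - r0) * (1 - r2))
          + r2 * ((1 - r0) * (1 - r1)))) := by ring
  rw [ident]
  linarith

/-- Set bookkeeping for frozen configurations: a union of bottoms splits into tops and defects. [this work] -/
theorem union_eq_tops_union_defects {t b : Fin 3 → Finset ι} (htb : ∀ l, t l ⊆ b l) (i j : Fin 3) :
    b i ∪ b j = (t i ∪ t j) ∪ ((b i \ t i) ∪ (b j \ t j)) := by
  ext x
  have ai : x ∈ t i → x ∈ b i := fun h => htb i h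
  have aj : x ∈ t j → x ∈ b j := fun h => htb j h
  simp only [mem_union, mem_sdiff]
  tauto

/-- **Frozen configurations**: if each defect `b_l ∖ t_l` misses the other two bottoms, then `T₃ ≥ 0`. [this work] -/
theorem T3cyl_nonneg_of_frozen [Fintype ι] (hp0 : ∀ e, 0 ≤ p e) (hp1 : ∀ e, p e ≤ 1) {t b : Fin 3 → Finset ι} (htb : ∀ l, t l ⊆ b l)
    (h0 : (b 0 \ t 0) ∩ (b 1 ∪ b 2) = ∅) (h1 : (b 1 \ t 1) ∩ (b 0 ∪ b 2) = ∅) (h2 : (b 2 \ t 2) ∩ (b 0 ∪ b 1) = ∅) :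
    0 ≤ T3cyl p t b := by
  -- disjointness bookkeeping: each defect misses every top and the other defects
  have h0' : Disjoint (b 0 \ t 0) (b 1 ∪ b 2) := disjoint_iff_inter_eq_empty.2 h0
  have h1' : Disjoint (b 1 \ t 1) (b 0 ∪ b 2) := disjoint_iff_inter_eq_empty.2 h1
  have h2' : Disjoint (b 2 \ t 2) (b 0 ∪ b 1) := disjoint_iff_inter_eq_empty.2 h2
  have d0t0 : Disjoint (t 0) (b 0 \ t 0) := disjoint_sdiff
  have d1t1 : Disjoint (t 1) (b 1 \ t 1) := disjoint_sdiff
  have d2t2 : Disjoint (t 2) (b 2 \ t 2) := disjoint_sdiff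
  have d0t1 : Disjoint (t 1) (b 0 \ t 0) := (h0'.mono_right ((htb 1).trans subset_union_left)).symm
  have d0t2 : Disjoint (t 2) (b 0 \ t 0) := (h0'.mono_right ((htb 2).trans subset_union_right)).symm
  have d1t0 : Disjoint (t 0) (b 1 \ t 1) := (h1'.mono_right ((htb 0).trans subset_union_left)).symm
  have d1t2 : Disjoint (t 2) (b 1 \ t 1) := (h1'.mono_right ((htb 2).trans subset_union_right)).symm
  have d2t0 : Disjoint (t 0) (b 2 \ t 2) := (h2'.mono_right ((htb 0).trans subset_union_left)).symm
  have d2t1 : Disjoint (t 1) (b 2 \ t 2) := (h2'.mono_right ((htb 1).trans subset_union_right)).symm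
  have d01 : Disjoint (b 0 \ t 0) (b 1 \ t 1) := h0'.mono_right (sdiff_subset.trans subset_union_left)
  have d02 : Disjoint (b 0 \ t 0) (b 2 \ t 2) := h0'.mono_right (sdiff_subset.trans subset_union_right)
  have d12 : Disjoint (b 1 \ t 1) (b 2 \ t 2) := h1'.mono_right (sdiff_subset.trans subset_union_right)
  -- factorisation of the bottom masses
  have Y : ∀ l, cylMass p (b l) = cylMass p (t l) * cylMass p (b l \ t l) := fun l => by
    rw [← cylMass_union_of_disjoint disjoint_sdiff, union_sdiff_of_subset (htb l)]
  have Y01 : cylMass p (b 0 ∪ b 1) = cylMass p (t 0 ∪ t 1) * (cylMass p (b 0 \ t 0) * cylMass p (b 1 \ t 1)) := by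
    rw [union_eq_tops_union_defects htb 0 1, cylMass_union_of_disjoint (disjoint_union_left.2
      ⟨disjoint_union_right.2 ⟨d0t0, d1t0⟩, disjoint_union_right.2 ⟨d0t1, d1t1⟩⟩), cylMass_union_of_disjoint d01]
  have Y02 : cylMass p (b 0 ∪ b 2) = cylMass p (t 0 ∪ t 2) * (cylMass p (b 0 \ t 0) * cylMass p (b 2 \ t 2)) := by
    rw [union_eq_tops_union_defects htb 0 2, cylMass_union_of_disjoint (disjoint_union_left.2
      ⟨disjoint_union_right.2 ⟨d0t0, d2t0⟩, disjoint_union_right.2 ⟨d0t2, d2t2⟩⟩), cylMass_union_of_disjoint d02]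
  have Y12 : cylMass p (b 1 ∪ b 2) = cylMass p (t 1 ∪ t 2) * (cylMass p (b 1 \ t 1) * cylMass p (b 2 \ t 2)) := by
    rw [union_eq_tops_union_defects htb 1 2, cylMass_union_of_disjoint (disjoint_union_left.2
      ⟨disjoint_union_right.2 ⟨d1t1, d2t1⟩, disjoint_union_right.2 ⟨d1t2, d2t2⟩⟩), cylMass_union_of_disjoint d12]
  have Y012 : cylMass p (b 0 ∪ b 1 ∪ b 2) =
      cylMass p (t 0 ∪ t 1 ∪ t 2) * (cylMass p (b 0 \ t 0) * cylMass p (b 1 \ t 1) * cylMass p (b 2 \ t 2)) := by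
    have e : b 0 ∪ b 1 ∪ b 2 = (t 0 ∪ t 1 ∪ t 2) ∪ ((b 0 \ t 0) ∪ (b 1 \ t 1) ∪ (b 2 \ t 2)) := by
      rw [union_eq_tops_union_defects htb 0 1]
      ext x
      have a2 : x ∈ t 2 → x ∈ b 2 := fun h => htb 2 h
      simp only [mem_union, mem_sdiff]
      tauto
    have hT : Disjoint (t 0 ∪ t 1 ∪ t 2) ((b 0 \ t 0) ∪ (b 1 \ t 1) ∪ (b 2 \ t 2)) :=
      disjoint_union_left.2 ⟨disjoint_union_left.2
        ⟨disjoint_union_right.2 ⟨disjoint_union_right.2 ⟨d0t0, d1t0⟩, d2t0⟩,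
         disjoint_union_right.2 ⟨disjoint_union_right.2 ⟨d0t1, d1t1⟩, d2t1⟩⟩,
        disjoint_union_right.2 ⟨disjoint_union_right.2 ⟨d0t2, d1t2⟩, d2t2⟩⟩
    rw [e, cylMass_union_of_disjoint hT, cylMass_union_of_disjoint (disjoint_union_left.2 ⟨d02, d12⟩),
      cylMass_union_of_disjoint d01]
  have key := frozen_poly_nonneg (cylMass_nonneg hp0 (t 0)) (cylMass_nonneg hp0 (t 1)) (cylMass_nonneg hp0 (t 2))
    (cylMass_mul_le_union hp0 hp1 (t 1) (t 2)) (cylMass_mul_le_union hp0 hp1 (t 0) (t 2)) (cylMass_mul_le_union hp0 hp1 (t 0) (t 1))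
    (E3cyl_nonneg hp0 hp1 t) (cylMass_nonneg hp0 (b 0 \ t 0)) (cylMass_nonneg hp0 (b 1 \ t 1)) (cylMass_nonneg hp0 (b 2 \ t 2))
    (cylMass_le_one hp0 hp1 (b 0 \ t 0)) (cylMass_le_one hp0 hp1 (b 1 \ t 1)) (cylMass_le_one hp0 hp1 (b 2 \ t 2))
  unfold T3cyl
  rw [Y 0, Y 1, Y 2, Y01, Y02, Y12, Y012]
  linarith

/-! ### The reduction -/

/-- Erasing from the first set a point of the others does not change a triple union. [this work] -/
theorem union₃_erase₀ {A B C : Finset ι} {e : ι} (h : e ∈ B ∪ C) : A.erase e ∪ B ∪ C = A ∪ B ∪ C := by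
  ext x
  rw [mem_union] at h
  simp only [mem_union, mem_erase]
  by_cases hxe : x = e
  · subst hxe; tauto
  · tauto

/-- Erasing from the second set a point of the others does not change a triple union. [this work] -/
theorem union₃_erase₁ {A B C : Finset ι} {e : ι} (h : e ∈ A ∪ C) : A ∪ B.erase e ∪ C = A ∪ B ∪ C := by
  ext x
  rw [mem_union] at h
  simp only [mem_union, mem_erase]
  by_cases hxe : x = e
  · subst hxe; tauto
  · tauto

/-- Erasing from the third set a point of the others does not change a triple union. [this work] -/
theorem union₃_erase₂ {A B C : Finset ι} {e : ι} (h : e ∈ A ∪ B) : A ∪ B ∪ C.erase e = A ∪ B ∪ C := by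
  ext x
  rw [mem_union] at h
  simp only [mem_union, mem_erase]
  by_cases hxe : x = e
  · subst hxe; tauto
  · tauto

/-- **Reduction step at slot `0`**: erasing from `b₀` a coordinate of `b₁ ∪ b₂` can only decrease `T₃`. [this work] -/
theorem T3cyl_erase_le₀ (hp0 : ∀ e, 0 ≤ p e) (hp1 : ∀ e, p e ≤ 1) (t b : Fin 3 → Finset ι) {e : ι} (he : e ∈ b 1 ∪ b 2) :
    T3cyl p t (Function.update b 0 ((b 0).erase e)) ≤ T3cyl p t b := by
  have n10 : (1 : Fin 3) ≠ 0 := by decide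
  have n20 : (2 : Fin 3) ≠ 0 := by decide
  unfold T3cyl
  rw [Function.update_self, Function.update_of_ne n10, Function.update_of_ne n20, union₃_erase₀ he]
  have u0 : cylMass p (b 0) ≤ cylMass p ((b 0).erase e) := cylMass_anti hp0 hp1 (erase_subset e (b 0))
  have u01 : cylMass p (b 0 ∪ b 1) ≤ cylMass p ((b 0).erase e ∪ b 1) :=
    cylMass_anti hp0 hp1 (union_subset_union (erase_subset e (b 0)) subset_rfl)
  have u02 : cylMass p (b 0 ∪ b 2) ≤ cylMass p ((b 0).erase e ∪ b 2) :=
    cylMass_anti hp0 hp1 (union_subset_union (erase_subset e (b 0)) subset_rfl)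
  have har12 := cylMass_mul_le_union hp0 hp1 (t 1) (t 2)
  have nX1 := cylMass_nonneg hp0 (p := p) (t 1)
  have nX2 := cylMass_nonneg hp0 (p := p) (t 2)
  nlinarith [mul_nonneg (sub_nonneg.2 u0) (sub_nonneg.2 har12), mul_nonneg nX2 (sub_nonneg.2 u01),
    mul_nonneg nX1 (sub_nonneg.2 u02)]

/-- Reduction step at slot `1`. [this work] -/
theorem T3cyl_erase_le₁ (hp0 : ∀ e, 0 ≤ p e) (hp1 : ∀ e, p e ≤ 1) (t b : Fin 3 → Finset ι) {e : ι} (he : e ∈ b 0 ∪ b 2) :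
    T3cyl p t (Function.update b 1 ((b 1).erase e)) ≤ T3cyl p t b := by
  have n01 : (0 : Fin 3) ≠ 1 := by decide
  have n21 : (2 : Fin 3) ≠ 1 := by decide
  have hun : b 0 ∪ (b 1).erase e ∪ b 2 = b 0 ∪ b 1 ∪ b 2 := union₃_erase₁ he
  unfold T3cyl
  rw [Function.update_self, Function.update_of_ne n01, Function.update_of_ne n21, hun]
  have u1 : cylMass p (b 1) ≤ cylMass p ((b 1).erase e) := cylMass_anti hp0 hp1 (erase_subset e (b 1))
  have u01 : cylMass p (b 0 ∪ b 1) ≤ cylMass p (b 0 ∪ (b 1).erase e) :=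
    cylMass_anti hp0 hp1 (union_subset_union subset_rfl (erase_subset e (b 1)))
  have u12 : cylMass p (b 1 ∪ b 2) ≤ cylMass p ((b 1).erase e ∪ b 2) :=
    cylMass_anti hp0 hp1 (union_subset_union (erase_subset e (b 1)) subset_rfl)
  have har02 := cylMass_mul_le_union hp0 hp1 (t 0) (t 2)
  have nX0 := cylMass_nonneg hp0 (p := p) (t 0)
  have nX2 := cylMass_nonneg hp0 (p := p) (t 2)
  nlinarith [mul_nonneg (sub_nonneg.2 u1) (sub_nonneg.2 har02), mul_nonneg nX2 (sub_nonneg.2 u01),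
    mul_nonneg nX0 (sub_nonneg.2 u12)]

/-- Reduction step at slot `2`. [this work] -/
theorem T3cyl_erase_le₂ (hp0 : ∀ e, 0 ≤ p e) (hp1 : ∀ e, p e ≤ 1) (t b : Fin 3 → Finset ι) {e : ι} (he : e ∈ b 0 ∪ b 1) :
    T3cyl p t (Function.update b 2 ((b 2).erase e)) ≤ T3cyl p t b := by
  have n02 : (0 : Fin 3) ≠ 2 := by decide
  have n12 : (1 : Fin 3) ≠ 2 := by decide
  have hun : b 0 ∪ b 1 ∪ (b 2).erase e = b 0 ∪ b 1 ∪ b 2 := union₃_erase₂ he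
  unfold T3cyl
  rw [Function.update_self, Function.update_of_ne n02, Function.update_of_ne n12, hun]
  have u2 : cylMass p (b 2) ≤ cylMass p ((b 2).erase e) := cylMass_anti hp0 hp1 (erase_subset e (b 2))
  have u02 : cylMass p (b 0 ∪ b 2) ≤ cylMass p (b 0 ∪ (b 2).erase e) :=
    cylMass_anti hp0 hp1 (union_subset_union subset_rfl (erase_subset e (b 2)))
  have u12 : cylMass p (b 1 ∪ b 2) ≤ cylMass p (b 1 ∪ (b 2).erase e) :=
    cylMass_anti hp0 hp1 (union_subset_union subset_rfl (erase_subset e (b 2)))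
  have har01 := cylMass_mul_le_union hp0 hp1 (t 0) (t 1)
  have nX0 := cylMass_nonneg hp0 (p := p) (t 0)
  have nX1 := cylMass_nonneg hp0 (p := p) (t 1)
  nlinarith [mul_nonneg (sub_nonneg.2 u2) (sub_nonneg.2 har01), mul_nonneg nX1 (sub_nonneg.2 u02),
    mul_nonneg nX0 (sub_nonneg.2 u12)]

end

end Summit.CriticalPhenomena.PercolationContinuityZ3.Theorems.SahiTangentCyl
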